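import Literature.NumberTheory.Rogawski1990.UnitaryTwoTypeTwoEdgeCount                  -- ★ B-p08 (g28) p843387: the type-(2) head `…_of_not_exists_isRoot`, `natCard_fixedBy_glInt_eq_sum_of_unitary`
import Literature.NumberTheory.Automorphic.UnitaryOrbitalIntegralSimilitudeFixedPoints   -- ★ B-p10 (g25): `natCard_fixedBy_quotient_eq_natCard_fixedBy_quotient_cmDatumLocalNonsplitCongr_symm`, `coe_localNonsplitEquiv_cmDatumLocalNonsplitCongr_symm`, `formCongr_glDiagonal_one_eq_smul_placeForm_antidiag`
import Literature.NumberTheory.Automorphic.UnitaryUnitOrbitalIntegralLatticeCount          -- ★ `natCard_fixedBy_quotient_congr`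
import HarnessLib

/-!
# Kottwitz's type-(2) elliptic relation on `U(Φ₂)(L⁺_v)`: `#Fix(U₂⧸K, γ) + #Fix(U₂⧸K′, γ) = #Fix(U₂⧸I, γ) + 1` (rootless characteristic polynomial)

Topic `NumberTheory/Automorphic`, namespace `Literature.NumberTheory.Automorphic.UnitaryGroup`.  THEOREMS ONLY: no definition, no named fact, no instance,
no notation, no `sorry`; kernel lane.  Brick (R5c′) of the (R2) Euler–Poincaré road for `stub_N6nsR2EP : RankOneEulerPoincareNonsplit` (EP pen B-p04 (g34)'s
handoff §3; glue ∕ assembler B-p14 (g32); LEAD F0P3a-plan (g10) WORD T9-8 (C)) — the TYPE-(2) twin of ★ B-p14 p843377 `UnitaryTwoEulerPoincareEllipticTypeOne`,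
SAME binder shape, so that the assembler reads both elliptic torus types through one `(E)`-clause.  Seat B-p08 (g28).  HONEST LABEL: HC_CM is proved only modulo the
cell's remaining named inputs (hLiu418, h413) until rung 0 closes; (R2) is a printed theorem [Kottwitz1988 §2 Thm 2], this file is unconditional bookkeeping.

THE MATHEMATICS.  `L` CM, `v` a finite place of `L⁺` UNRAMIFIED and NON-SPLIT in `L`, `w ∣ v` (`c • w = w`), `σ_w`, `ϖ ∈ L_w^×` a `σ_w`-fixed uniformiser,
`d = diag(1, ϖ)`, `q = q_v`.  Three subgroups `C, C′, I ≤ U₂ = (cmDatum L 2 Φ₂).Local v` with the one-place membership characterisations of ★ (R5c)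
(`u ∈ C ↔ u_w ∈ GL₂(𝒪_w)`, `u ∈ C′ ↔ u_w ∈ d GL₂(𝒪_w) d⁻¹`, `u ∈ I ↔ u_w ∈ Iwahori`).  For `γ ∈ U₂` whose one-place image `γ_w = e_w γ` has ROOTLESS characteristic
polynomial over `L_w`, integral trace, `|2|_w = 1` and `|tr² − 4det|_w = exp(−(2N+1))` (type (2): the anisotropic torus `(EK)¹`, `K∕L⁺_v` ramified):
**`V_C(γ) + V_{C′}(γ) = E(γ) + 1`** with `V_C = V_{C′} = Σ_(k≤N) q^k` and `E = 2Σ_(k≤N) q^k − 1` — the Euler characteristic `χ(X^γ) = 1` of the fixed ball of radius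
`N + ½` about an edge midpoint [Kottwitz1988, §2 Thm 2].  PROOF (all inputs ★): (a) `E(γ) + 1 = 2Σ q^k` is ★ B-p08 `natCard_fixedBy_iwahori_add_one_eq_two_mul_sum_of_not_exists_isRoot`
at `γ_w`, transported to `U₂ ⧸ I` by ★ `natCard_fixedBy_quotient_congr`; (b) `V_C(γ) = Σ_(k≤N) q^k` is ★ `natCard_fixedBy_glInt_eq_sum_of_unitary` at `γ_w`; (c) `V_{C′}(γ) =
V_C(e_d⁻¹ γ)` (★ B-p10 `natCard_fixedBy_quotient_eq_natCard_fixedBy_quotient_cmDatumLocalNonsplitCongr_symm`) and `(e_d⁻¹ γ)_w = d⁻¹ γ_w d` (★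
`coe_localNonsplitEquiv_cmDatumLocalNonsplitCongr_symm`) has the SAME trace, determinant and characteristic polynomial, so (b) applies again — NO parity flip for
type (2), both vertex colours are counted alike; (d) `P + P = (2P − 1) + 1` on the collected equalities.

## References
* [Kottwitz1988] R. E. Kottwitz, *Tamagawa numbers*, Ann. of Math. 127 (1988), 629–646, §2 Theorem 2 (`O_γ(f_EP) = χ(X^γ) = 1` for elliptic `γ`).
* [Rogawski1990] J. D. Rogawski, *Automorphic Representations of Unitary Groups in Three Variables* (1990), §3.6 p. 31 (the tori `(EK)¹`), §12.6 p. 174.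
* [Serre1980Trees] J.-P. Serre, *Trees* (1980), Ch. II §1.1.
-/

set_option autoImplicit false

noncomputable section

open scoped ValuativeRel Matrix MatrixGroups
open Matrix ValuativeRel Finset NumberField IsDedekindDomain MulAction

namespace Literature.NumberTheory.Automorphic.UnitaryGroup

/-- `tr(T⁻¹ g T) = tr g` in `GL₂`. [cite: Kottwitz1988, §2] -/
private theorem trace_coe_conj {F : Type*} [Field F] (T g : GL (Fin 2) F) :
    ((T⁻¹ * g * T : GL (Fin 2) F) : Matrix (Fin 2) (Fin 2) F).trace = (g : Matrix (Fin 2) (Fin 2) F).trace := by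
  rw [Units.val_mul, Units.val_mul]; exact Matrix.trace_units_conj' _ _

/-- `det(T⁻¹ g T) = det g` in `GL₂`. [cite: Kottwitz1988, §2] -/
private theorem det_coe_conj {F : Type*} [Field F] (T g : GL (Fin 2) F) :
    ((T⁻¹ * g * T : GL (Fin 2) F) : Matrix (Fin 2) (Fin 2) F).det = (g : Matrix (Fin 2) (Fin 2) F).det := by
  rw [Units.val_mul, Units.val_mul]; exact Matrix.det_units_conj' _ _

section CM

variable (L : Type) [Field L] [NumberField L] [IsCMField L] (v : HeightOneSpectrum (𝓞 ↥(maximalRealSubfield L)))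
  (w : PlacesOver L v) (hw : IsCMField.complexConj L • w.1 = w.1)

include hw in
/-- **KOTTWITZ'S TYPE-(2) ELLIPTIC RELATION `V_C + V_{C′} = E + 1` ON `U₂`, HYPOTHESIS FORM** (the twin of ★ `natCard_fixedBy_add_eq_natCard_fixedBy_add_one_of_eigenframe`):
at a finite place `v` unramified and non-split in `L`, for subgroups `C, C′, I ≤ U₂` characterised at `w` by `GL₂(𝒪_w)`, `d GL₂(𝒪_w) d⁻¹` (`d = diag(1, ϖ)`, `ϖ` ANY
`σ_w`-fixed unit of `L_w` — the uniformiser in the application; unlike the type-(1) twin no `hϖ` is needed, both colours count alike) and the Iwahori, and `γ ∈ U₂` with `χ_{γ,w}` ROOTLESS over `L_w`, `tr γ_w ∈ 𝒪_w`, `|2|_w = 1`, `|tr² − 4det|_w = exp(−(2N+1))`: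
`#Fix(U₂ ⧸ C, γ) + #Fix(U₂ ⧸ C′, γ) = #Fix(U₂ ⧸ I, γ) + 1` (`Σ + Σ = (2Σ − 1) + 1`, `Σ = Σ_(k≤N) q_v^k`). [cite: Kottwitz1988, §2 Theorem 2] [cite: Rogawski1990, §12.6 p. 174] -/
theorem natCard_fixedBy_add_eq_natCard_fixedBy_add_one_of_not_exists_isRoot (hunr : Algebra.IsUnramifiedIn (𝓞 L) v.asIdeal)
    (ϖ : (w.1.adicCompletion L)ˣ)
    (hσϖ : (galAdicCompletionMap (L := L) (IsCMField.complexConj L) hw) (ϖ : (w.1.adicCompletion L)) = ϖ)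
    (C C' I : Subgroup ((cmDatum L 2 (Matrix.of fun i j : Fin 2 => if i.val + j.val + 1 = 2 then (1 : L) else 0)).Local v))
    (hC : ∀ g, g ∈ C ↔ (((localNonsplitEquiv (IsCMField.complexConj L) (Matrix.of fun i j : Fin 2 => if i.val + j.val + 1 = 2 then (1 : L) else 0) (IsCMField.complexConj_ne_one L) w hw) g : ↥(unitaryGroupOfForm (galAdicCompletionMap (L := L) (IsCMField.complexConj L) hw) (placeForm (Matrix.of fun i j : Fin 2 => if i.val + j.val + 1 = 2 then (1 : L) else 0) w.1))) : GL (Fin 2) (w.1.adicCompletion L)) ∈ glInt 2 (w.1.adicCompletion L))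
    (hC' : ∀ g, g ∈ C' ↔ (((localNonsplitEquiv (IsCMField.complexConj L) (Matrix.of fun i j : Fin 2 => if i.val + j.val + 1 = 2 then (1 : L) else 0) (IsCMField.complexConj_ne_one L) w hw) g : ↥(unitaryGroupOfForm (galAdicCompletionMap (L := L) (IsCMField.complexConj L) hw) (placeForm (Matrix.of fun i j : Fin 2 => if i.val + j.val + 1 = 2 then (1 : L) else 0) w.1))) : GL (Fin 2) (w.1.adicCompletion L)) ∈ (glInt 2 (w.1.adicCompletion L)).map (MulAut.conj (glDiagonal 2 (w.1.adicCompletion L) ![1, ϖ])).toMonoidHom)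
    (hI : ∀ g, g ∈ I ↔ (((localNonsplitEquiv (IsCMField.complexConj L) (Matrix.of fun i j : Fin 2 => if i.val + j.val + 1 = 2 then (1 : L) else 0) (IsCMField.complexConj_ne_one L) w hw) g : ↥(unitaryGroupOfForm (galAdicCompletionMap (L := L) (IsCMField.complexConj L) hw) (placeForm (Matrix.of fun i j : Fin 2 => if i.val + j.val + 1 = 2 then (1 : L) else 0) w.1))) : GL (Fin 2) (w.1.adicCompletion L)) ∈ iwahoriGL 2 (w.1.adicCompletion L))
    (γ : ((cmDatum L 2 (Matrix.of fun i j : Fin 2 => if i.val + j.val + 1 = 2 then (1 : L) else 0)).Local v))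
    (h2v : valuation (w.1.adicCompletion L) 2 = 1) (ht : ((((localNonsplitEquiv (IsCMField.complexConj L) (Matrix.of fun i j : Fin 2 => if i.val + j.val + 1 = 2 then (1 : L) else 0) (IsCMField.complexConj_ne_one L) w hw) γ : ↥(unitaryGroupOfForm (galAdicCompletionMap (L := L) (IsCMField.complexConj L) hw) (placeForm (Matrix.of fun i j : Fin 2 => if i.val + j.val + 1 = 2 then (1 : L) else 0) w.1))) : GL (Fin 2) (w.1.adicCompletion L)) : Matrix (Fin 2) (Fin 2) (w.1.adicCompletion L)).trace ∈ 𝒪[(w.1.adicCompletion L)])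
    (hirr : ¬ ∃ x : (w.1.adicCompletion L), (((((localNonsplitEquiv (IsCMField.complexConj L) (Matrix.of fun i j : Fin 2 => if i.val + j.val + 1 = 2 then (1 : L) else 0) (IsCMField.complexConj_ne_one L) w hw) γ : ↥(unitaryGroupOfForm (galAdicCompletionMap (L := L) (IsCMField.complexConj L) hw) (placeForm (Matrix.of fun i j : Fin 2 => if i.val + j.val + 1 = 2 then (1 : L) else 0) w.1))) : GL (Fin 2) (w.1.adicCompletion L)) : Matrix (Fin 2) (Fin 2) (w.1.adicCompletion L)).charpoly).IsRoot x)
    (N : ℕ) (hN : Valued.v (((((localNonsplitEquiv (IsCMField.complexConj L) (Matrix.of fun i j : Fin 2 => if i.val + j.val + 1 = 2 then (1 : L) else 0) (IsCMField.complexConj_ne_one L) w hw) γ : ↥(unitaryGroupOfForm (galAdicCompletionMap (L := L) (IsCMField.complexConj L) hw) (placeForm (Matrix.of fun i j : Fin 2 => if i.val + j.val + 1 = 2 then (1 : L) else 0) w.1))) : GL (Fin 2) (w.1.adicCompletion L)) : Matrix (Fin 2) (Fin 2) (w.1.adicCompletion L)).trace ^ 2 - 4 * ((((localNonsplitEquiv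 (IsCMField.complexConj L) (Matrix.of fun i j : Fin 2 => if i.val + j.val + 1 = 2 then (1 : L) else 0) (IsCMField.complexConj_ne_one L) w hw) γ : ↥(unitaryGroupOfForm (galAdicCompletionMap (L := L) (IsCMField.complexConj L) hw) (placeForm (Matrix.of fun i j : Fin 2 => if i.val + j.val + 1 = 2 then (1 : L) else 0) w.1))) : GL (Fin 2) (w.1.adicCompletion L)) : Matrix (Fin 2) (Fin 2) (w.1.adicCompletion L)).det) = WithZero.exp (-((2 * N + 1 : ℕ) : ℤ))) :
    Nat.card (fixedBy (((cmDatum L 2 (Matrix.of fun i j : Fin 2 => if i.val + j.val + 1 = 2 then (1 : L) else 0)).Local v) ⧸ C) γ) + Nat.card (fixedBy (((cmDatum L 2 (Matrix.of fun i j : Fin 2 => if i.val + j.val + 1 = 2 then (1 : L) else 0)).Local v) ⧸ C') γ) = Nat.card (fixedBy (((cmDatum L 2 (Matrix.of fun i j : Fin 2 => if i.val + j.val + 1 = 2 then (1 : L) else 0)).Local v) ⧸ I) γ) + 1 := by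
  classical
  have hform := formCongr_glDiagonal_one_eq_smul_placeForm_antidiag L w hw ϖ hσϖ
  -- (a) the edge count, transported to `U₂ ⧸ I`
  have hE : Nat.card (fixedBy (((cmDatum L 2 (Matrix.of fun i j : Fin 2 => if i.val + j.val + 1 = 2 then (1 : L) else 0)).Local v) ⧸ I) γ) = Nat.card (fixedBy (↥(unitaryGroupOfForm (galAdicCompletionMap (L := L) (IsCMField.complexConj L) hw) (placeForm (Matrix.of fun i j : Fin 2 => if i.val + j.val + 1 = 2 then (1 : L) else 0) w.1)) ⧸ (iwahoriGL 2 (w.1.adicCompletion L)).subgroupOf (unitaryGroupOfForm (galAdicCompletionMap (L := L) (IsCMField.complexConj L) hw) (placeForm (Matrix.of fun i j : Fin 2 => if i.val + j.val + 1 = 2 then (1 : L) else 0) w.1))) ((localNonsplitEquiv (IsCMField.complexConj L) (Matrix.of fun i j : Fin 2 => if i.val + j.val + 1 = 2 then (1 : L) else 0) (IsCMField.complexConj_ne_one L) w hw) γ)) :=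
    natCard_fixedBy_quotient_congr I _ (localNonsplitEquiv (IsCMField.complexConj L) (Matrix.of fun i j : Fin 2 => if i.val + j.val + 1 = 2 then (1 : L) else 0) (IsCMField.complexConj_ne_one L) w hw).toMulEquiv (fun g => (hI g).trans Subgroup.mem_subgroupOf.symm) γ
  have hEsum := natCard_fixedBy_iwahori_add_one_eq_two_mul_sum_of_not_exists_isRoot L v w hw hunr ((localNonsplitEquiv (IsCMField.complexConj L) (Matrix.of fun i j : Fin 2 => if i.val + j.val + 1 = 2 then (1 : L) else 0) (IsCMField.complexConj_ne_one L) w hw) γ) h2v ht hirr N hN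
  -- (b) the vertex count at `C`
  have hV : Nat.card (fixedBy (((cmDatum L 2 (Matrix.of fun i j : Fin 2 => if i.val + j.val + 1 = 2 then (1 : L) else 0)).Local v) ⧸ C) γ) = Nat.card (fixedBy (↥(unitaryGroupOfForm (galAdicCompletionMap (L := L) (IsCMField.complexConj L) hw) (placeForm (Matrix.of fun i j : Fin 2 => if i.val + j.val + 1 = 2 then (1 : L) else 0) w.1)) ⧸ (glInt 2 (w.1.adicCompletion L)).subgroupOf (unitaryGroupOfForm (galAdicCompletionMap (L := L) (IsCMField.complexConj L) hw) (placeForm (Matrix.of fun i j : Fin 2 => if i.val + j.val + 1 = 2 then (1 : L) else 0) w.1))) ((localNonsplitEquiv (IsCMField.complexConj L) (Matrix.of fun i j : Fin 2 => if i.val + j.val + 1 = 2 then (1 : L) else 0) (IsCMField.complexConj_ne_one L) w hw) γ)) :=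
    natCard_fixedBy_quotient_congr C _ (localNonsplitEquiv (IsCMField.complexConj L) (Matrix.of fun i j : Fin 2 => if i.val + j.val + 1 = 2 then (1 : L) else 0) (IsCMField.complexConj_ne_one L) w hw).toMulEquiv (fun g => (hC g).trans Subgroup.mem_subgroupOf.symm) γ
  have hVsum := natCard_fixedBy_glInt_eq_sum_of_unitary L v w hw hunr ((localNonsplitEquiv (IsCMField.complexConj L) (Matrix.of fun i j : Fin 2 => if i.val + j.val + 1 = 2 then (1 : L) else 0) (IsCMField.complexConj_ne_one L) w hw) γ) h2v ht hirr N hN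
  -- (c) the vertex count at `C′` = the count at `C` for `γ₁ = e_d⁻¹ γ`, whose one-place image is the conjugate `d⁻¹ γ_w d`
  have hV' := natCard_fixedBy_quotient_eq_natCard_fixedBy_quotient_cmDatumLocalNonsplitCongr_symm L 2 (Matrix.of fun i j : Fin 2 => if i.val + j.val + 1 = 2 then (1 : L) else 0) w hw (glDiagonal 2 (w.1.adicCompletion L) ![1, ϖ]) ϖ.isUnit hform
    (glInt 2 (w.1.adicCompletion L)) C C' hC hC' γ
  have hcoe₁ := coe_localNonsplitEquiv_cmDatumLocalNonsplitCongr_symm L 2 (Matrix.of fun i j : Fin 2 => if i.val + j.val + 1 = 2 then (1 : L) else 0) w hw (glDiagonal 2 (w.1.adicCompletion L) ![1, ϖ]) ϖ.isUnit hform γ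
  have hV₁ : Nat.card (fixedBy (((cmDatum L 2 (Matrix.of fun i j : Fin 2 => if i.val + j.val + 1 = 2 then (1 : L) else 0)).Local v) ⧸ C) ((cmDatumLocalNonsplitCongr L w hw (glDiagonal 2 (w.1.adicCompletion L) ![1, ϖ]) ϖ.isUnit (formCongr_glDiagonal_one_eq_smul_placeForm_antidiag L w hw ϖ hσϖ)).symm γ)) =
      Nat.card (fixedBy (↥(unitaryGroupOfForm (galAdicCompletionMap (L := L) (IsCMField.complexConj L) hw) (placeForm (Matrix.of fun i j : Fin 2 => if i.val + j.val + 1 = 2 then (1 : L) else 0) w.1)) ⧸ (glInt 2 (w.1.adicCompletion L)).subgroupOf (unitaryGroupOfForm (galAdicCompletionMap (L := L) (IsCMField.complexConj L) hw) (placeForm (Matrix.of fun i j : Fin 2 => if i.val + j.val + 1 = 2 then (1 : L) else 0) w.1))) ((localNonsplitEquiv (IsCMField.complexConj L) (Matrix.of fun i j : Fin 2 => if i.val + j.val + 1 = 2 then (1 : L) else 0) (IsCMField.complexConj_ne_one L) w hw) ((cmDatumLocalNonsplitCongr L w hw (glDiagonal 2 (w.1.adicCompletion L) ![1, ϖ])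 ϖ.isUnit (formCongr_glDiagonal_one_eq_smul_placeForm_antidiag L w hw ϖ hσϖ)).symm γ))) :=
    natCard_fixedBy_quotient_congr C _ (localNonsplitEquiv (IsCMField.complexConj L) (Matrix.of fun i j : Fin 2 => if i.val + j.val + 1 = 2 then (1 : L) else 0) (IsCMField.complexConj_ne_one L) w hw).toMulEquiv (fun g => (hC g).trans Subgroup.mem_subgroupOf.symm) _
  -- (no `rw` in goals mentioning both `γ_w` and `(e_d⁻¹ γ)_w`: `kabstract` would compare the two and time out — term-mode `congrArg` + generic conjugation lemmas)
  have htr₁ := (congrArg (fun g : GL (Fin 2) (w.1.adicCompletion L) => (g : Matrix (Fin 2) (Fin 2) (w.1.adicCompletion L)).trace) hcoe₁).trans (trace_coe_conj _ _)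
  have hdet₁ := (congrArg (fun g : GL (Fin 2) (w.1.adicCompletion L) => (g : Matrix (Fin 2) (Fin 2) (w.1.adicCompletion L)).det) hcoe₁).trans (det_coe_conj _ _)
  have ht₁ : ((((localNonsplitEquiv (IsCMField.complexConj L) (Matrix.of fun i j : Fin 2 => if i.val + j.val + 1 = 2 then (1 : L) else 0) (IsCMField.complexConj_ne_one L) w hw) ((cmDatumLocalNonsplitCongr L w hw (glDiagonal 2 (w.1.adicCompletion L) ![1, ϖ]) ϖ.isUnit (formCongr_glDiagonal_one_eq_smul_placeForm_antidiag L w hw ϖ hσϖ)).symm γ) : ↥(unitaryGroupOfForm (galAdicCompletionMap (L := L) (IsCMField.complexConj L) hw) (placeForm (Matrix.of fun i j : Fin 2 => if i.val + j.val + 1 = 2 then (1 : L) else 0) w.1))) : GL (Fin 2) (w.1.adicCompletion L)) : Matrix (Fin 2) (Fin 2) (w.1.adicCompletion L)).trace ∈ 𝒪[(w.1.adicCompletion L)] := by rw [htr₁]; exact ht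
  have hirr₁ : ¬ ∃ x : (w.1.adicCompletion L), (((((localNonsplitEquiv (IsCMField.complexConj L) (Matrix.of fun i j : Fin 2 => if i.val + j.val + 1 = 2 then (1 : L) else 0) (IsCMField.complexConj_ne_one L) w hw) ((cmDatumLocalNonsplitCongr L w hw (glDiagonal 2 (w.1.adicCompletion L) ![1, ϖ]) ϖ.isUnit (formCongr_glDiagonal_one_eq_smul_placeForm_antidiag L w hw ϖ hσϖ)).symm γ) : ↥(unitaryGroupOfForm (galAdicCompletionMap (L := L) (IsCMField.complexConj L) hw) (placeForm (Matrix.of fun i j : Fin 2 => if i.val + j.val + 1 = 2 then (1 : L) else 0) w.1))) : GL (Fin 2) (w.1.adicCompletion L)) : Matrix (Fin 2) (Fin 2) (w.1.adicCompletion L)).charpoly).IsRoot x := by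
    -- (rewrite inside `hx` only: a `rw [htr₁]` in a goal that also mentions `γ_w` makes `kabstract` compare `(e_d⁻¹ γ)_w` with `γ_w` and time out)
    rintro ⟨x, hx⟩
    rw [Matrix.charpoly_fin_two, htr₁, hdet₁] at hx
    exact hirr ⟨x, by rw [Matrix.charpoly_fin_two]; exact hx⟩
  have hN₁ : Valued.v (((((localNonsplitEquiv (IsCMField.complexConj L) (Matrix.of fun i j : Fin 2 => if i.val + j.val + 1 = 2 then (1 : L) else 0) (IsCMField.complexConj_ne_one L) w hw) ((cmDatumLocalNonsplitCongr L w hw (glDiagonal 2 (w.1.adicCompletion L) ![1, ϖ]) ϖ.isUnit (formCongr_glDiagonal_one_eq_smul_placeForm_antidiag L w hw ϖ hσϖ)).symm γ) : ↥(unitaryGroupOfForm (galAdicCompletionMap (L := L) (IsCMField.complexConj L) hw) (placeForm (Matrix.of fun i j : Fin 2 => if i.val + j.val + 1 = 2 then (1 : L) else 0) w.1))) : GL (Fin 2) (w.1.adicCompletion L)) : Matrix (Fin 2) (Fin 2) (w.1.adicCompletion L)).trace ^ 2 - 4 * ((((localNonsplitEquiv (IsCMField.complexConj L) (Matrix.of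 fun i j : Fin 2 => if i.val + j.val + 1 = 2 then (1 : L) else 0) (IsCMField.complexConj_ne_one L) w hw) ((cmDatumLocalNonsplitCongr L w hw (glDiagonal 2 (w.1.adicCompletion L) ![1, ϖ]) ϖ.isUnit (formCongr_glDiagonal_one_eq_smul_placeForm_antidiag L w hw ϖ hσϖ)).symm γ) : ↥(unitaryGroupOfForm (galAdicCompletionMap (L := L) (IsCMField.complexConj L) hw) (placeForm (Matrix.of fun i j : Fin 2 => if i.val + j.val + 1 = 2 then (1 : L) else 0) w.1))) : GL (Fin 2) (w.1.adicCompletion L)) : Matrix (Fin 2) (Fin 2) (w.1.adicCompletion L)).det) = WithZero.exp (-((2 * N + 1 : ℕ) : ℤ)) := by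
    rw [htr₁, hdet₁]; exact hN
  have hVsum₁ := natCard_fixedBy_glInt_eq_sum_of_unitary L v w hw hunr ((localNonsplitEquiv (IsCMField.complexConj L) (Matrix.of fun i j : Fin 2 => if i.val + j.val + 1 = 2 then (1 : L) else 0) (IsCMField.complexConj_ne_one L) w hw) ((cmDatumLocalNonsplitCongr L w hw (glDiagonal 2 (w.1.adicCompletion L) ![1, ϖ]) ϖ.isUnit (formCongr_glDiagonal_one_eq_smul_placeForm_antidiag L w hw ϖ hσϖ)).symm γ)) h2v ht₁ hirr₁ N hN₁
  -- (d) assemble: `Σ + Σ = (2Σ − 1) + 1` (term-mode collection, `omega`)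
  omega

end CM

end Literature.NumberTheory.Automorphic.UnitaryGroup

end
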